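import Mathlib
import HarnessLib
import Summits.CriticalPhenomena.Ising3DConformalLimit.Theses.EnergyNotSigmaSquared
import Literature.Probability.LatticeModels.RandomCurrents
import Literature.Probability.LatticeModels.SharpLengthDCP

/-!
# Sketch — crux ideas for `EnergyGapPowerLaw` (stmt-CriticalPhenomena-4469), round 1, ideator 1

First lemmas of the two filed idea cards (`Ideas/markov-square-screening.md` = Card A,
`Ideas/neighbouring-iic-avoidance.md` = Card B) and of one examined-but-unfiled lever (β-flow,
NOTES.md L2), stated over existing declarations. Proofs are NOT the
business of this stage (`sorry`); the file only has to elaborate.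
-/

noncomputable section

namespace Summit.CriticalPhenomena.Ising3DConformalLimit.Cruxes.EnergyGapPowerLaw.Sketch

open Literature.Probability.LatticeModels MeasureTheory
open scoped BigOperators ENNReal

/-! ## Common vocabulary -/

/-- The unit vector `e₂ = (0,1,0)` of the crux. -/
abbrev e₂ : Site 3 := Pi.single 1 1

/-- Central energy density `⟨σ₀σ_{e₂}⟩^{bc}_{B_R; β_c(3), h=0}` of the box `B_R = {‖y‖_∞ ≤ R}` with
boundary condition `bc` (finite volume, tree's `isingExpect`). -/
def boxEnergy (R : ℕ) (bc : BoundaryCondition (Site 3)) : ℝ :=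
  isingExpect (zdGraph 3) (box 3 R) (criticalBeta 3) 0 bc (spinPair (0 : Site 3) e₂)

/-- Plus-boundary magnetisation `M_R^+ = ⟨σ₀⟩^+_{B_R; β_c(3), 0}` at the centre of the box. -/
def boxMag (R : ℕ) : ℝ :=
  isingExpect (zdGraph 3) (box 3 R) (criticalBeta 3) 0 .plus (spinAt (0 : Site 3))

/-- The truncated critical energy–energy correlation `⟨σ₀σ_{e₂} ; σ_xσ_{x+e₂}⟩_{β_c}` — the
left-hand side of the crux `EnergyGapPowerLaw`, verbatim. -/
def energyCov (x : Site 3) : ℝ :=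
  criticalCorr 3 4 ![0, (Pi.single 1 1 : Site 3), x, x + Pi.single 1 1] -
    criticalCorr 3 2 ![0, (Pi.single 1 1 : Site 3)] * criticalCorr 3 2 ![x, x + Pi.single 1 1]

/-! ## Card A (`markov-square-screening`) — Markov square: two-box conditional independence

FIRST LEMMA. If every spin boundary condition `τ` shifts the central energy density of `B_R` by
at most `D` relative to the plus condition, then for every `x` whose `R`-box is separated from
`B_R(0)` (`‖x‖_∞ ≥ 2R+2`, no nearest-neighbour bond between the boxes) the truncated
energy–energy correlation is at most `4D²`. Proof route (provable now): DLR for the unique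
critical state `μ` (`exists_plusMeasure_holds`, `hasUniqueGibbsMeasure_criticalBeta`) on the
disconnected volume `B_R(0) ∪ B_R(x)`, whose finite-volume Gibbs measure with fixed boundary
condition is the product of the two box measures (the Hamiltonian splits), so that
`⟨ε₀ε_x⟩ = ∫ a₀(τ) a_x(τ) dμ`, `⟨ε₀⟩ = ∫ a₀ dμ`, `⟨ε_x⟩ = ∫ a_x dμ` with
`a₀(τ) = boxEnergy R (.fixed τ)`; hence `Cov = ∫ (a₀ - ā)(a_x - ā) dμ ≤ (2D)·(2D)`. -/
theorem markovSquare (R : ℕ) (hR : 1 ≤ R) (D : ℝ)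
    (hD : ∀ τ : SpinConfig (Site 3), |boxEnergy R (.fixed τ) - boxEnergy R .plus| ≤ D)
    (x : Site 3) (hx : 2 * (R : ℝ) + 2 ≤ ‖x‖) :
    energyCov x ≤ 4 * D ^ 2 := by
  sorry

/-- TRANSFERRED CRUX `C⁺` of card A (even sector, one box, finite volume): UNIFORM ENERGY
SCREENING — every boundary condition shifts the central energy density of `B_R` at `β_c(3)` by
at most `C R^{-κ}` times the SQUARED plus magnetisation (`κ = 0` for `τ ≡ +` is GHS; predicted
exponent `Δ_ε − 2Δ_σ ≈ 0.376`; FALSE for `d ≥ 5`, where `ε = :σ²:` and a Dobrushin condition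
already gives a shift `≍ (M_R^+)²`). -/
def UniformEnergyScreening : Prop :=
  ∃ κ C : ℝ, 0 < κ ∧ ∀ R : ℕ, 1 ≤ R → ∀ τ : SpinConfig (Site 3),
    |boxEnergy R (.fixed τ) - boxEnergy R .plus| ≤ C * (R : ℝ) ^ (-κ) * boxMag R ^ 2

/-- THE WALL of card A (odd sector): plus-box quasi-multiplicativity — the squared plus
magnetisation of `B_R` is at most a constant times the critical two-point function across the
box pair (`2R+2 ≤ ‖x‖_∞ ≤ 2R+3`). The REVERSE inequality `⟨σ₀σ_x⟩ ≤ (M_R^+)²` is one line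
(GKS: `⟨σ₀σ_x⟩_{ℤ³} ≤ ⟨σ₀σ_x⟩^+_{B_R(0) ∪ B_R(x)} = ⟨σ₀⟩^+_{B_R(0)}⟨σ_x⟩^+_{B_R(x)}`). -/
def PlusBoxQuasiMultiplicativity : Prop :=
  ∃ C : ℝ, ∀ R : ℕ, 1 ≤ R → ∀ x : Site 3, 2 * (R : ℝ) + 2 ≤ ‖x‖ → ‖x‖ ≤ 2 * (R : ℝ) + 3 →
    boxMag R ^ 2 ≤ C * criticalTwoPoint 3 x

/-- How the crux is meant to follow (words; the checked composition is crux-plan business):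
for `‖x‖_∞ = N ≥ 4` put `R = ⌊(N-2)/2⌋`, so `2R+2 ≤ N ≤ 2R+3`; `markovSquare` with
`D = C R^{-κ} (M_R^+)²` and the wall give `energyCov x ≤ 4C²C'² R^{-2κ} ⟨σ₀σ_x⟩²`; the finitely
many `x` with `‖x‖_∞ ≤ 3` are absorbed since `⟨σ₀σ_x⟩_{β_c} ≥ c‖x‖⁻² > 0`
(`criticalTwoPoint_bounds_holds`). Recorded as a `Prop` only. -/
def CardOneComposition : Prop :=
  UniformEnergyScreening → PlusBoxQuasiMultiplicativity →
    Summit.CriticalPhenomena.Ising3DConformalLimit.Theses.EnergyNotSigmaSquared.EnergyGapPowerLaw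

/-! ## Lever L2 (examined, NOT filed as a card) — β-flow: avoidance at criticality as the exponential of an integrated current deficit

FIRST LEMMA (finite graph, pure calculus on the tree's `doubleCurrentMeasure`): the probability of
any event `S` of current pairs under `P^A_β ⊗ P^B_β` is differentiable in `β > 0` with derivative
`β⁻¹ Cov_β(N₁ + N₂, 1_S)`, `N_i = Σ_e n_i(e)` the total current — because `w_β(n) = ∏ β^{n_e}/n_e!`
has logarithmic derivative `N(n)/β`. Applied to `S = {0 ↮ e₂ in n₁+n₂}` with `A = {0,x}`,
`B = {e₂, x+e₂}` this is the flow equation `d/dβ log A_Λ(β) = -β⁻¹ D_Λ(β)`,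
`D_Λ = E[N] - E[N | avoid] ≥ ?`. -/
theorem hasDerivAt_doubleCurrentMeasure_real {V : Type} [Fintype V] [DecidableEq V]
    (G : SimpleGraph V) [DecidableRel G.Adj] (A B : Finset V)
    (S : Set (Current G × Current G)) {β : ℝ} (hβ : 0 < β)
    (hA : 0 < currentSum G β A) (hB : 0 < currentSum G β B) :
    HasDerivAt (fun b : ℝ => (doubleCurrentMeasure G b A B).real S)
      (β⁻¹ * ((∫ p in S, (∑ e, ((p.1 e + p.2 e : ℕ) : ℝ)) ∂(doubleCurrentMeasure G β A B)) -
        (∫ p, (∑ e, ((p.1 e + p.2 e : ℕ) : ℝ)) ∂(doubleCurrentMeasure G β A B)) *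
          (doubleCurrentMeasure G β A B).real S)) β := by
  sorry

/-- The induced nearest-neighbour graph of `ℤ³` on the box `Λ_N` (as in the route's item
`RungOneAdjacentMerging`, rev 2). -/
abbrev boxGraph (N : ℕ) : SimpleGraph ↥(box 3 N) := (zdGraph 3).comap Subtype.val

/-- Finite-volume adjacent-source AVOIDANCE probability
`A_N(β; o,a,y,y') = P^{oy}_{Λ_N,β} ⊗ P^{ay'}_{Λ_N,β}[o ↮ a in n₁+n₂]` (route notation: `A_par`
when `o = 0`, `a = e₂`, `y = x`, `y' = x + e₂`). -/
def boxAvoid (N : ℕ) (β : ℝ) (o a y y' : ↥(box 3 N)) : ℝ :=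
  (doubleCurrentMeasure (boxGraph N) β (symmDiff {o} {y}) (symmDiff {a} {y'})).real
    (tracedConn (boxGraph N) o a)ᶜ

/-- C⁺ of lever L2 (unfiled): PER-OCTAVE CONTRACTION ALONG THE β-FLOW. Whenever the
Duminil-Copin–Panis sharp length doubles between `β < β' ≤ β_c(3)` while staying below the target
distance, the finite-volume adjacent avoidance drops by a fixed factor `1 - δ`, uniformly in the
volume `Λ_N ⊇ B_{2‖x‖}`. With `A_N ≤ 1` at the first octave and `⌊log₂ ‖x‖⌋ - k₀` doublings
available below `‖x‖` (`L(β) → ∞` as `β ↑ β_c`, `L(β_c) = ∞`), this gives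
`A_N(β_c; 0,e₂,x,x+e₂) ≤ C‖x‖^{-κ}`, `κ = -log₂(1-δ)`, uniformly in `N`, and the crux follows from
`EnergyFactorisation` (route item, provable now) and the box limit `N → ∞`. -/
def PerOctaveFlowContraction : Prop :=
  ∃ δ : ℝ, 0 < δ ∧ ∃ k₀ : ℕ, ∀ (β β' : ℝ), 0 < β → β < β' → β' ≤ criticalBeta 3 →
    ∀ (k : ℕ), k₀ ≤ k → sharpLength 3 β ≤ (2 ^ k : ℕ) → ((2 ^ (k + 1) : ℕ) : ℕ∞) ≤ sharpLength 3 β' →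
    ∀ (x : Site 3), (2 : ℝ) ^ (k + 2) ≤ ‖x‖ →
    ∀ (N : ℕ), 2 * ‖x‖ ≤ (N : ℝ) →
    ∀ (o a y y' : ↥(box 3 N)), (o : Site 3) = 0 → (a : Site 3) = e₂ → (y : Site 3) = x →
      (y' : Site 3) = x + e₂ →
      boxAvoid N β' o a y y' ≤ (1 - δ) * boxAvoid N β o a y y'


/-! ## Card B (`neighbouring-iic-avoidance`) — neighbouring incipient clusters: localise the avoidance, then send the targets away

FIRST LEMMA (finite volume, provable now from the route's `EnergyFactorisation` (item 4472) and
the inclusion `{o ↮ a} ⊆ {o ↮ a inside Λ_k}`): the truncated energy–energy correlation in the free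
box `Λ_N` is at most the two-point prefactors times the LOCALISED avoidance probabilities of the two
pairings. The right-hand side depends on the targets `y, y'` only through the law of the currents
inside `Λ_k`, which is where the incipient-cluster limit (Panis 2025, Thm 3.1: `y, y' → ∞`
"regardless of the manner") and its bounded-distortion refinement act. -/

/-- Bonds of the box graph `Λ_N` with both endpoints in the sub-box `Λ_k`. -/
def bondsWithin (N k : ℕ) : Set (Sym2 ↥(box 3 N)) :=
  {s | ∀ v ∈ s, (v : Site 3) ∈ box 3 k}

/-- The LOCALISED connection event "`o ↔ a` by bonds of `n₁ + n₂` lying inside `Λ_k`". -/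
def tracedConnWithin (N k : ℕ) (o a : ↥(box 3 N)) :
    Set (Current (boxGraph N) × Current (boxGraph N)) :=
  {p | (Literature.Probability.Percolation.openGraph ((p.1 + p.2).traced ∩ bondsWithin N k)).Reachable o a}

/-- Localised avoidance `P^{oy}_{Λ_N} ⊗ P^{ay'}_{Λ_N}[o ↮ a inside Λ_k]`. -/
def boxAvoidWithin (N k : ℕ) (β : ℝ) (o a y y' : ↥(box 3 N)) : ℝ :=
  (doubleCurrentMeasure (boxGraph N) β (symmDiff {o} {y}) (symmDiff {a} {y'})).real
    (tracedConnWithin N k o a)ᶜ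

/-- Free-boundary two-point function of the box `Λ_N`. -/
def boxTwoPoint (N : ℕ) (β : ℝ) (u v : ↥(box 3 N)) : ℝ :=
  isingTwoPoint (boxGraph N) Finset.univ β 0 .free u v

theorem energyCov_box_le_localisedAvoidance (N k : ℕ) {β : ℝ} (hβ : 0 ≤ β)
    (o a y y' : ↥(box 3 N)) :
    nPoint (isingMeasure (boxGraph N) Finset.univ β 0 .free) spinAt ![o, a, y, y'] -
        boxTwoPoint N β o a * boxTwoPoint N β y y' ≤
      boxTwoPoint N β o y * boxTwoPoint N β a y' * boxAvoidWithin N k β o a y y' +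
        boxTwoPoint N β o y' * boxTwoPoint N β a y * boxAvoidWithin N k β o a y' y := by
  sorry

/-- TRANSFERRED CRUX `C⁺` of card B, finite-volume typeable form: TARGET-UNIFORM LOCAL AVOIDANCE —
adjacent-source currents avoid each other inside `Λ_k` with probability `≤ C k^{-κ}` uniformly in
the volume and in the position of the far targets (beyond `Λ_{2k}`), at `β_c(3)`. In the limit
`y, y' → ∞` (Panis 2025 Thm 3.1) the left side is the avoidance, inside `Λ_k`, of the two
NEIGHBOURING INCIPIENT INFINITE CLUSTERS `𝐂(0)`, `𝐂(e₂)` under `P^{0∞, e₂∞}`; the card splits `C⁺`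
accordingly into an IIC avoidance exponent and a bounded-distortion (Harnack-type) comparison. -/
def TargetUniformLocalAvoidance : Prop :=
  ∃ κ C : ℝ, 0 < κ ∧ ∃ k₀ : ℕ, ∀ k : ℕ, k₀ ≤ k → ∀ N : ℕ, 4 * k ≤ N →
    ∀ (o a y y' : ↥(box 3 N)), (o : Site 3) = 0 → (a : Site 3) = e₂ →
      (2 * k : ℝ) ≤ ‖(y : Site 3)‖ → (2 * k : ℝ) ≤ ‖(y' : Site 3)‖ →
      2 * ‖(y : Site 3)‖ ≤ (N : ℝ) → 2 * ‖(y' : Site 3)‖ ≤ (N : ℝ) →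
      boxAvoidWithin N k (criticalBeta 3) o a y y' ≤ C * (k : ℝ) ^ (-κ)

end Summit.CriticalPhenomena.Ising3DConformalLimit.Cruxes.EnergyGapPowerLaw.Sketch

end
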